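import Literature.AlgebraicGeometry.Modules.PullbackStalk
import Literature.AlgebraicGeometry.Modules.StalkCriteria
import Literature.AlgebraicGeometry.Modules.FlatteningStratificationDecomposition
import Literature.Algebra.Module.KernelBaseChangeDescent
import Mathlib.RingTheory.Flat.FaithfullyFlat.Basic
import Mathlib.RingTheory.LocalRing.ResidueField.Basic
import HarnessLib

/-!
# Nakayama for sheaves: a map onto a finite-type `𝒪_T`-module that is fibrewise surjective is an epimorphism

Layer `Literature/AlgebraicGeometry/Modules` (0 definitions, 0 named facts, no instances, no notation). For a scheme `T`,
a morphism `φ : M ⟶ N` of `𝒪_T`-modules with `N` STALKWISE FINITE (every stalk `N_t` a finitely generated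
`𝒪_{T,t}`-module — e.g. `N` coherent, e.g. `N` finite locally free), and points `t ∈ T`:

* (ring level, Nakayama one step up) `surjective_of_surjective_lTensor_of_isLocalHom`: for a LOCAL homomorphism of local
  rings `R → S` and `d : P → Q` linear with `Q` finite over `R`, if `S ⊗_R d` is onto then `d` is onto (`S ⊗_R coker d = 0`
  ⇒ `κ_S ⊗_{κ_R} (κ_R ⊗_R coker d) = 0` ⇒ `κ_R ⊗_R coker d = 0`, `κ_S` being faithfully flat over the field `κ_R` ⇒ `coker d = 0`
  by Nakayama);
* (one point) `stalkFunctor_map_surjective_of_pullback`: for ANY morphism `g : X ⟶ T` and `p ∈ X`, if the stalk of `g^*φ` at `p`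
  is onto then the stalk of `φ` at `g p` is onto — by the stalk formula `(g^*N)_p ≅ 𝒪_{X,p} ⊗_{𝒪_{T,g p}} N_{g p}`
  (`Modules/PullbackStalk.stalkPullbackIso`, natural in `N`) and the ring lemma for the local homomorphism `g_p♯`;
* (heads) **`epi_of_forall_exists_pullback_stalk_surjective`**: if every `t` is the image of a point `p` of some `g : X ⟶ T`
  at which the stalk of `g^*φ` is onto, then `Epi φ` (epimorphisms of `𝒪_T`-modules are detected on stalks,
  `Modules/StalkCriteria`); `epi_of_forall_exists_epi_pullback_map` (same with `Epi (g^*φ)`);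
  **`epi_of_epi_pullback_map_of_surjective`** — PULL-BACK ALONG A SURJECTIVE MORPHISM REFLECTS EPIMORPHISMS onto finite-type
  modules (no flatness);
* (field points) `Spec K` for a field `K` is a one-point space, so `Γ(Spec K, –) → stalk` is onto and
  **`epi_of_forall_fieldPoint_app_top_surjective`**: if for every `t` there is a field point `x : Spec K ⟶ T` through `t` with
  `Γ(Spec K, x^*M) → Γ(Spec K, x^*N)` onto, then `Epi φ`; the `∀`-field-points form `epi_of_forall_fieldPoint_app_top_surjective'`;
  front doors for `N` coherent (`Coh`) and finite locally free (`IsFiniteLocallyFree`).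

No flatness, no Noetherian hypothesis, no quasi-coherence of `M` is used. This is the sheaf form of Nakayama's lemma
(Stacks 01B8 / Görtz–Wedhorn I Prop. 7.30 with Nakayama Prop. B.3; EGA I (Springer) 0.5.2.2), written for the cell
`hodgecm-mathlib` (D-0151), F-DAG F-5 (5d-I) step S3 «`𝒪_T ⊗ H⁰(ℙ^m, 𝒪(d)) ↠ (p_Z)_*𝒪_Z(d)` is onto because it is onto on every
fibre» (Mumford, *Curves on an algebraic surface*, Lect. 15 (II)); count-neutral capital; HC_CM is proved only modulo the 7
printed citations until rung 0 closes; nothing here is about HC.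

## References

* U. Görtz, T. Wedhorn, *Algebraic Geometry I: Schemes*, 2nd ed. (2020), Exercise 2.18 (one-point ringed spaces: `𝓕(X) = 𝓕_x`), (7.8.6) (stalks of the inverse image), Prop. 7.30 and
  Cor. 7.31 (modules of finite type: generation at a stalk spreads), Cor. 7.42 (finite locally free modules), Prop. B.3 (Nakayama's
  lemma). [GortzWedhorn2020]
* R. Hartshorne, *Algebraic Geometry*, GTM 52 (1977), II Ex. 1.2 (b) (p. 66) (epi ⇔ onto on stalks), II Prop. 5.4 (p. 113).
  [Hartshorne1977]
* The Stacks Project, Tag 01B8 (Lemma 17.9.4: a map onto a finite-type module which is onto at a stalk is onto near the point),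
  Tag 00DV (Lemma 10.20.1, Nakayama's lemma). [StacksProject]
* D. Mumford, *Lectures on Curves on an Algebraic Surface*, Annals of Math. Studies 59 (1966), Lecture 15, (II.)–(III.)
  (pp. 106–107). [Mumford1966CurvesSurface]
-/

noncomputable section

-- `TopCat.Presheaf`/`Scheme.Modules` are not reducible (as in Mathlib's `AlgebraicGeometry/Modules`).
set_option backward.isDefEq.respectTransparency false

universe u

open CategoryTheory CategoryTheory.Limits AlgebraicGeometry TopologicalSpace Opposite TensorProduct

namespace Literature.AlgebraicGeometry.Modules

open Literature.AlgebraicGeometry.Motives Literature.AlgebraicGeometry.Morphisms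

/-! ## §1 Ring level: Nakayama one step up a local homomorphism -/

section Ring

variable {R S : Type u} [CommRing R] [CommRing S] [IsLocalRing R] [IsLocalRing S] [Algebra R S]
  [IsLocalHom (algebraMap R S)]

/-- A tensor product with a trivial module is trivial. [folklore] -/
private theorem subsingleton_tensor_of_subsingleton_right (A : Type u) [CommRing A] (B : Type u) [AddCommGroup B]
    [Module A B] (C : Type u) [AddCommGroup C] [Module A C] [Subsingleton C] : Subsingleton (B ⊗[A] C) :=
  subsingleton_of_forall_eq 0 fun z => z.induction_on rfl
    (fun b c => by rw [Subsingleton.elim c 0, tmul_zero]) (fun x y hx hy => by rw [hx, hy, add_zero])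

/-- **Nakayama, one step up a local homomorphism.** Let `R → S` be a LOCAL homomorphism of local rings, `Q` a finite
`R`-module and `d : P → Q` an `R`-linear map. If `S ⊗_R d : S ⊗_R P → S ⊗_R Q` is onto, then `d` is onto: `S ⊗_R coker d = 0`,
hence `κ_S ⊗_R coker d = κ_S ⊗_{κ_R} (κ_R ⊗_R coker d) = 0`, hence `κ_R ⊗_R coker d = 0` (`κ_S` is faithfully flat over the
FIELD `κ_R`), hence `coker d = 0` by Nakayama. [cite: StacksProject, Tag 00DV (Lemma 10.20.1)] [cite: GortzWedhorn2020, Prop. B.3 (Nakayama's lemma)] -/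
theorem surjective_of_surjective_lTensor_of_isLocalHom {P Q : Type u} [AddCommGroup P] [Module R P] [AddCommGroup Q]
    [Module R Q] [Module.Finite R Q] (d : P →ₗ[R] Q) (h : Function.Surjective (d.lTensor S)) :
    Function.Surjective d := by
  set C := Q ⧸ LinearMap.range d
  -- `S ⊗_R C = 0`
  have hS : Subsingleton (S ⊗[R] C) := by
    rw [← LinearMap.baseChange_eq_ltensor] at h
    exact (Literature.Algebra.Module.surjective_baseChange_iff_subsingleton_tensor_coker d S).1 h
  -- `κ_S ⊗_R C = κ_S ⊗_S (S ⊗_R C) = 0`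
  have hkS : Subsingleton (IsLocalRing.ResidueField S ⊗[R] C) := by
    haveI := subsingleton_tensor_of_subsingleton_right S (IsLocalRing.ResidueField S) (S ⊗[R] C)
    exact (TensorProduct.AlgebraTensorModule.cancelBaseChange R S (IsLocalRing.ResidueField S)
      (IsLocalRing.ResidueField S) C).symm.toEquiv.subsingleton
  -- `κ_S ⊗_R C = κ_S ⊗_{κ_R} (κ_R ⊗_R C)`, and `κ_S` is faithfully flat over the field `κ_R`
  have hkRS : Subsingleton (IsLocalRing.ResidueField S ⊗[IsLocalRing.ResidueField R]
      (IsLocalRing.ResidueField R ⊗[R] C)) :=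
    (TensorProduct.AlgebraTensorModule.cancelBaseChange R (IsLocalRing.ResidueField R) (IsLocalRing.ResidueField S)
      (IsLocalRing.ResidueField S) C).toEquiv.subsingleton
  haveI : Module.FaithfullyFlat (IsLocalRing.ResidueField R) (IsLocalRing.ResidueField S) := inferInstance
  have hkR : Subsingleton (IsLocalRing.ResidueField R ⊗[R] C) :=
    (Module.FaithfullyFlat.subsingleton_tensorProduct_iff_right (IsLocalRing.ResidueField R)
      (IsLocalRing.ResidueField S)).1 hkRS
  -- Nakayama
  have hC : Subsingleton C := (IsLocalRing.subsingleton_tensorProduct (R := R)).1 hkR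
  rw [← LinearMap.range_eq_top]
  exact Submodule.Quotient.subsingleton_iff.1 hC

/-- The `baseChange` form of `surjective_of_surjective_lTensor_of_isLocalHom`. [cite: StacksProject, Tag 00DV (Lemma 10.20.1)] -/
theorem surjective_of_surjective_baseChange_of_isLocalHom {P Q : Type u} [AddCommGroup P] [Module R P] [AddCommGroup Q]
    [Module R Q] [Module.Finite R Q] (d : P →ₗ[R] Q) (h : Function.Surjective (d.baseChange S)) :
    Function.Surjective d :=
  surjective_of_surjective_lTensor_of_isLocalHom (S := S) d (by rwa [LinearMap.baseChange_eq_ltensor] at h)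

end Ring

/-! ## §2 One point: the stalk of `g^*φ` at `p` is `𝒪_{X,p} ⊗ φ_{g p}` -/

section Point

variable {X T : Scheme.{u}} (g : X ⟶ T) {M N : T.Modules} (φ : M ⟶ N) (p : X)

/-- Under the stalk formula `(g^*N)_p ≅ 𝒪_{X,p} ⊗_{𝒪_{T,g p}} N_{g p}` (natural in `N`), the stalk map of `g^*φ` at `p` is
surjective iff `𝒪_{X,p} ⊗ φ_{g p}` is. [cite: GortzWedhorn2020, (7.8.6)] -/
theorem stalkFunctor_map_pullback_surjective_iff :
    Function.Surjective ((stalkFunctor p).map ((Scheme.Modules.pullback g).map φ)) ↔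
      Function.Surjective ((ModuleCat.extendScalars.{u, u, u} (g.stalkMap p).hom).map ((stalkFunctor (g.base p)).map φ)) := by
  have hnat := (stalkPullbackIso g p).hom.naturality φ
  have h : (stalkFunctor (g.base p) ⋙ ModuleCat.extendScalars.{u, u, u} (g.stalkMap p).hom).map φ =
      (stalkPullbackIso g p).inv.app M ≫ (Scheme.Modules.pullback g ⋙ stalkFunctor p).map φ ≫
        (stalkPullbackIso g p).hom.app N := by
    rw [hnat, Iso.inv_hom_id_app_assoc]
  change _ ↔ Function.Surjective ((stalkFunctor (g.base p) ⋙ ModuleCat.extendScalars.{u, u, u} (g.stalkMap p).hom).map φ)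
  rw [h]
  change Function.Surjective ((Scheme.Modules.pullback g ⋙ stalkFunctor p).map φ) ↔ _
  constructor
  · intro hs
    change Function.Surjective (((stalkPullbackIso g p).inv.app M ≫
      (Scheme.Modules.pullback g ⋙ stalkFunctor p).map φ ≫ (stalkPullbackIso g p).hom.app N).hom)
    rw [ModuleCat.hom_comp, ModuleCat.hom_comp, LinearMap.coe_comp, LinearMap.coe_comp]
    exact ((ModuleCat.epi_iff_surjective _).mp inferInstance).comp
      (hs.comp ((ModuleCat.epi_iff_surjective _).mp inferInstance))
  · intro hs
    have h' : (Scheme.Modules.pullback g ⋙ stalkFunctor p).map φ =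
        (stalkPullbackIso g p).hom.app M ≫ ((stalkPullbackIso g p).inv.app M ≫
          (Scheme.Modules.pullback g ⋙ stalkFunctor p).map φ ≫ (stalkPullbackIso g p).hom.app N) ≫
            (stalkPullbackIso g p).inv.app N := by
      simp only [Category.assoc, Iso.hom_inv_id_app, Category.comp_id, Iso.hom_inv_id_app_assoc]
    rw [h']
    change Function.Surjective (((stalkPullbackIso g p).hom.app M ≫ ((stalkPullbackIso g p).inv.app M ≫
      (Scheme.Modules.pullback g ⋙ stalkFunctor p).map φ ≫ (stalkPullbackIso g p).hom.app N) ≫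
        (stalkPullbackIso g p).inv.app N).hom)
    rw [ModuleCat.hom_comp, ModuleCat.hom_comp, LinearMap.coe_comp, LinearMap.coe_comp]
    exact ((ModuleCat.epi_iff_surjective _).mp inferInstance).comp
      (hs.comp ((ModuleCat.epi_iff_surjective _).mp inferInstance))

/-- **One point.** For ANY morphism `g : X ⟶ T`, a point `p ∈ X` and `φ : M ⟶ N` with `N_{g p}` a finite `𝒪_{T,g p}`-module:
if the stalk map of `g^*φ` at `p` is onto, then the stalk map of `φ` at `g p` is onto (stalk formula + Nakayama one step up
the local homomorphism `g_p♯ : 𝒪_{T,g p} → 𝒪_{X,p}`). [cite: GortzWedhorn2020, (7.8.6) and Prop. B.3 (Nakayama's lemma)] -/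
theorem stalkFunctor_map_surjective_of_pullback
    [Module.Finite (T.presheaf.stalk (g.base p)) ((stalkFunctor (g.base p)).obj N)]
    (h : Function.Surjective ((stalkFunctor p).map ((Scheme.Modules.pullback g).map φ))) :
    Function.Surjective ((stalkFunctor (g.base p)).map φ) := by
  have hs := (stalkFunctor_map_pullback_surjective_iff g φ p).1 h
  algebraize [(g.stalkMap p).hom]
  haveI : IsLocalHom (algebraMap (T.presheaf.stalk (g.base p)) (X.presheaf.stalk p)) := g.toLRSHom.prop p
  -- the base-changed map is `lTensor` of the stalk map
  have hl : ((ModuleCat.extendScalars.{u, u, u} (g.stalkMap p).hom).map ((stalkFunctor (g.base p)).map φ) :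
        _ → _) = ((stalkFunctor (g.base p)).map φ).hom.lTensor (X.presheaf.stalk p) := by
    ext t
    induction t using TensorProduct.induction_on with
    | zero => simp
    | tmul s m => rfl
    | add a b ha hb => rw [map_add, map_add, ha, hb]
  rw [hl] at hs
  exact surjective_of_surjective_lTensor_of_isLocalHom (S := X.presheaf.stalk p) _ hs

/-- The `Epi` form of `stalkFunctor_map_surjective_of_pullback`: if `g^*φ` is an epimorphism then the stalk of `φ` at every
point in the image of `g` is onto. [cite: GortzWedhorn2020, (7.8.6) and Prop. B.3 (Nakayama's lemma)] [cite: Hartshorne1977, II Ex. 1.2 (b) (p. 66)] -/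
theorem stalkFunctor_map_surjective_of_epi_pullback_map
    [Module.Finite (T.presheaf.stalk (g.base p)) ((stalkFunctor (g.base p)).obj N)]
    [Epi ((Scheme.Modules.pullback g).map φ)] : Function.Surjective ((stalkFunctor (g.base p)).map φ) :=
  stalkFunctor_map_surjective_of_pullback g φ p (stalkFunctor_map_surjective_of_epi p _)

end Point

/-! ## §3 Heads: epimorphisms detected after pull-back -/

section Heads

variable {T : Scheme.{u}} {M N : T.Modules} (φ : M ⟶ N)

/-- **Nakayama for sheaves, pull-back form.** Let `φ : M ⟶ N` with `N` stalkwise finite. If every point `t ∈ T` is the image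
of a point `p` of some scheme `X` under some `g : X ⟶ T` such that the stalk map of `g^*φ` at `p` is onto, then `φ` is an
epimorphism. [cite: StacksProject, Tag 01B8 (Lemma 17.9.4)] [cite: GortzWedhorn2020, Prop. 7.30] [cite: Hartshorne1977, II Ex. 1.2 (b) (p. 66)] -/
theorem epi_of_forall_exists_pullback_stalk_surjective
    (hN : ∀ t : T, Module.Finite (T.presheaf.stalk t) ((stalkFunctor t).obj N))
    (h : ∀ t : T, ∃ (X : Scheme.{u}) (g : X ⟶ T) (p : X), g.base p = t ∧
      Function.Surjective ((stalkFunctor p).map ((Scheme.Modules.pullback g).map φ))) : Epi φ := by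
  refine epi_of_stalkFunctor_map_surjective φ fun t => ?_
  obtain ⟨X, g, p, rfl, hs⟩ := h t
  haveI := hN (g.base p)
  exact stalkFunctor_map_surjective_of_pullback g φ p hs

/-- **Nakayama for sheaves, `Epi` form**: if every `t ∈ T` is in the image of some `g : X ⟶ T` with `Epi (g^*φ)`, and `N` is
stalkwise finite, then `Epi φ`. [cite: StacksProject, Tag 01B8 (Lemma 17.9.4)] [cite: GortzWedhorn2020, Prop. 7.30] -/
theorem epi_of_forall_exists_epi_pullback_map
    (hN : ∀ t : T, Module.Finite (T.presheaf.stalk t) ((stalkFunctor t).obj N))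
    (h : ∀ t : T, ∃ (X : Scheme.{u}) (g : X ⟶ T) (p : X), g.base p = t ∧ Epi ((Scheme.Modules.pullback g).map φ)) :
    Epi φ := by
  refine epi_of_forall_exists_pullback_stalk_surjective φ hN fun t => ?_
  obtain ⟨X, g, p, hp, hepi⟩ := h t
  exact ⟨X, g, p, hp, stalkFunctor_map_surjective_of_epi p _⟩

/-- **Pull-back along a SURJECTIVE morphism reflects epimorphisms onto finite-type modules** (no flatness needed): if
`g : X ⟶ T` is surjective, `N` is stalkwise finite and `g^*φ` is an epimorphism, then so is `φ`.
[cite: StacksProject, Tag 01B8 (Lemma 17.9.4)] [cite: GortzWedhorn2020, Prop. 7.30 and (7.8.6)] -/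
theorem epi_of_epi_pullback_map_of_surjective {X : Scheme.{u}} (g : X ⟶ T) [Surjective g]
    (hN : ∀ t : T, Module.Finite (T.presheaf.stalk t) ((stalkFunctor t).obj N))
    [Epi ((Scheme.Modules.pullback g).map φ)] : Epi φ := by
  refine epi_of_forall_exists_epi_pullback_map φ hN fun t => ?_
  obtain ⟨p, hp⟩ := ‹Surjective g›.surj t
  exact ⟨X, g, p, hp, inferInstance⟩

end Heads

/-! ## §4 Field points: `Spec K` is a one-point space -/

section FieldPoint

variable {K : Type u} [Field K]

/-- On `Spec K`, `K` a field, every open neighbourhood of a point is `⊤` (`Spec K` is a one-point space).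
[cite: GortzWedhorn2020, Exercise 2.18] -/
theorem opens_eq_top_of_mem_spec_of_field {U : (Spec (.of K)).Opens} {q : ↥(Spec (.of K))} (hq : q ∈ U) : U = ⊤ := by
  ext y
  simp only [Opens.coe_top, Set.mem_univ, iff_true]
  rwa [Subsingleton.elim y q]

/-- On `Spec K`, `K` a field, every element of the stalk of an `𝒪`-module at a point is the germ of a GLOBAL section
(`𝓕(X) = 𝓕_x` on a one-point space). [cite: GortzWedhorn2020, Exercise 2.18] -/
theorem exists_stalkGerm_top_eq_of_field (L : (Spec (.of K)).Modules) (q : ↥(Spec (.of K)))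
    (v : (stalkFunctor q).obj L) : ∃ s : Γ(L, ⊤), stalkGerm q L ⊤ trivial s = v := by
  obtain ⟨U, hq, s, rfl⟩ := exists_stalkGerm_eq q L v
  obtain rfl := opens_eq_top_of_mem_spec_of_field hq
  exact ⟨s, rfl⟩

/-- On `Spec K`, `K` a field, a morphism of `𝒪`-modules which is onto on global sections is onto on the stalk at any point
(`𝓕(X) = 𝓕_x` on a one-point space). [cite: GortzWedhorn2020, Exercise 2.18] -/
theorem stalkFunctor_map_surjective_of_app_top_surjective_of_field {L L' : (Spec (.of K)).Modules} (ψ : L ⟶ L')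
    (h : Function.Surjective (ψ.app ⊤)) (q : ↥(Spec (.of K))) : Function.Surjective ((stalkFunctor q).map ψ) := by
  intro v
  obtain ⟨s, rfl⟩ := exists_stalkGerm_top_eq_of_field L' q v
  obtain ⟨s', rfl⟩ := h s
  exact ⟨stalkGerm q L ⊤ trivial s', stalkFunctor_map_germ q ψ ⊤ trivial s'⟩

variable {T : Scheme.{u}} {M N : T.Modules} (φ : M ⟶ N)

/-- **Nakayama for sheaves, field-point form** (the F-5 (5d-I) S3 letter). Let `N` be stalkwise finite. If for every `t ∈ T`
there is a field point `x : Spec K ⟶ T` through `t` such that `Γ(Spec K, x^*M) → Γ(Spec K, x^*N)` is onto, then `Epi φ`.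
(Choosing `K` infinite, e.g. an algebraic closure of `κ(t)`, is allowed.) [cite: StacksProject, Tag 01B8 (Lemma 17.9.4)]
[cite: GortzWedhorn2020, Prop. 7.30 and (7.8.6)] -/
theorem epi_of_forall_fieldPoint_app_top_surjective
    (hN : ∀ t : T, Module.Finite (T.presheaf.stalk t) ((stalkFunctor t).obj N))
    (h : ∀ t : T, ∃ (K : Type u) (_ : Field K) (x : Spec (.of K) ⟶ T), t ∈ Set.range x.base ∧
      Function.Surjective (((Scheme.Modules.pullback x).map φ).app ⊤)) : Epi φ := by
  refine epi_of_forall_exists_pullback_stalk_surjective φ hN fun t => ?_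
  obtain ⟨K, _, x, ⟨q, hq⟩, hs⟩ := h t
  exact ⟨Spec (.of K), x, q, hq, stalkFunctor_map_surjective_of_app_top_surjective_of_field _ hs q⟩

/-- **Nakayama for sheaves, all field points.** If `N` is stalkwise finite and `Γ(Spec K, x^*M) → Γ(Spec K, x^*N)` is onto
for EVERY field point `x : Spec K ⟶ T`, then `Epi φ`. [cite: StacksProject, Tag 01B8 (Lemma 17.9.4)] [cite: GortzWedhorn2020, Prop. 7.30] -/
theorem epi_of_forall_fieldPoint_app_top_surjective'
    (hN : ∀ t : T, Module.Finite (T.presheaf.stalk t) ((stalkFunctor t).obj N))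
    (h : ∀ ⦃K : Type u⦄ [Field K] (x : Spec (.of K) ⟶ T), Function.Surjective (((Scheme.Modules.pullback x).map φ).app ⊤)) :
    Epi φ := by
  refine epi_of_forall_fieldPoint_app_top_surjective φ hN fun t => ?_
  exact ⟨T.residueField t, inferInstance, T.fromSpecResidueField t, ⟨default, Scheme.fromSpecResidueField_apply t _⟩, h _⟩

end FieldPoint

/-! ## §5 Front doors: `N` coherent, `N` finite locally free -/

section FrontDoors

variable {T : Scheme.{u}} {M N : T.Modules} (φ : M ⟶ N)

/-- A coherent module is stalkwise finite. [cite: Hartshorne1977, II Prop. 5.4 (p. 113)] [cite: GortzWedhorn2020, Prop. 7.30] -/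
theorem forall_moduleFinite_stalk_of_coh (hN : Coh N) :
    ∀ t : T, Module.Finite (T.presheaf.stalk t) ((stalkFunctor t).obj N) :=
  fun t => moduleFinite_stalk_of_coh t hN

/-- A finite locally free module is coherent (affine-localizing and of affine-finite type). [cite: GortzWedhorn2020, Cor. 7.42] -/
theorem coh_of_isFiniteLocallyFree (hN : IsFiniteLocallyFree N) : Coh N :=
  ⟨IsFiniteLocallyFree.isAffineLocalizing hN, IsFiniteLocallyFree.isAffineFiniteType hN⟩

/-- A finite locally free module is stalkwise finite. [cite: GortzWedhorn2020, Cor. 7.42] [cite: Hartshorne1977, II Prop. 5.4 (p. 113)] -/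
theorem forall_moduleFinite_stalk_of_isFiniteLocallyFree (hN : IsFiniteLocallyFree N) :
    ∀ t : T, Module.Finite (T.presheaf.stalk t) ((stalkFunctor t).obj N) :=
  forall_moduleFinite_stalk_of_coh (coh_of_isFiniteLocallyFree hN)

/-- **Nakayama for coherent sheaves, field-point form**: `N` coherent; if through every `t ∈ T` there is a field point `x`
with `Γ(x^*φ)` onto, then `Epi φ`. [cite: StacksProject, Tag 01B8 (Lemma 17.9.4)] [cite: Hartshorne1977, II Ex. 1.2 (b) (p. 66)] -/
theorem epi_of_forall_fieldPoint_app_top_surjective_of_coh (hN : Coh N)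
    (h : ∀ t : T, ∃ (K : Type u) (_ : Field K) (x : Spec (.of K) ⟶ T), t ∈ Set.range x.base ∧
      Function.Surjective (((Scheme.Modules.pullback x).map φ).app ⊤)) : Epi φ :=
  epi_of_forall_fieldPoint_app_top_surjective φ (forall_moduleFinite_stalk_of_coh hN) h

/-- All-field-points form for a coherent target. [cite: StacksProject, Tag 01B8 (Lemma 17.9.4)]
[cite: Hartshorne1977, II Ex. 1.2 (b) (p. 66)] -/
theorem epi_of_forall_fieldPoint_app_top_surjective_of_coh' (hN : Coh N)
    (h : ∀ ⦃K : Type u⦄ [Field K] (x : Spec (.of K) ⟶ T), Function.Surjective (((Scheme.Modules.pullback x).map φ).app ⊤)) :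
    Epi φ :=
  epi_of_forall_fieldPoint_app_top_surjective' φ (forall_moduleFinite_stalk_of_coh hN) h

/-- **Nakayama for finite locally free targets, field-point form** (the F-5 (5d-I) S3 letter: `N = (p_Z)_*𝒪_Z(d)` finite
locally free): if through every `t ∈ T` there is a field point `x` with `Γ(x^*φ)` onto, then `Epi φ`.
[cite: StacksProject, Tag 01B8 (Lemma 17.9.4)] [cite: Mumford1966CurvesSurface, Lecture 15, (II.)–(III.) (pp. 106–107)] -/
theorem epi_of_forall_fieldPoint_app_top_surjective_of_isFiniteLocallyFree (hN : IsFiniteLocallyFree N)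
    (h : ∀ t : T, ∃ (K : Type u) (_ : Field K) (x : Spec (.of K) ⟶ T), t ∈ Set.range x.base ∧
      Function.Surjective (((Scheme.Modules.pullback x).map φ).app ⊤)) : Epi φ :=
  epi_of_forall_fieldPoint_app_top_surjective φ (forall_moduleFinite_stalk_of_isFiniteLocallyFree hN) h

/-- All-field-points form for a finite locally free target. [cite: StacksProject, Tag 01B8 (Lemma 17.9.4)] [cite: Mumford1966CurvesSurface, Lecture 15, (II.)–(III.) (pp. 106–107)] -/
theorem epi_of_forall_fieldPoint_app_top_surjective_of_isFiniteLocallyFree' (hN : IsFiniteLocallyFree N)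
    (h : ∀ ⦃K : Type u⦄ [Field K] (x : Spec (.of K) ⟶ T), Function.Surjective (((Scheme.Modules.pullback x).map φ).app ⊤)) :
    Epi φ :=
  epi_of_forall_fieldPoint_app_top_surjective' φ (forall_moduleFinite_stalk_of_isFiniteLocallyFree hN) h

/-- **Pull-back along a surjective morphism reflects epimorphisms onto finite locally free modules.**
[cite: StacksProject, Tag 01B8 (Lemma 17.9.4)] [cite: GortzWedhorn2020, Prop. 7.30 and (7.8.6)] -/
theorem epi_of_epi_pullback_map_of_surjective_of_isFiniteLocallyFree {X : Scheme.{u}} (g : X ⟶ T) [Surjective g]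
    (hN : IsFiniteLocallyFree N) [Epi ((Scheme.Modules.pullback g).map φ)] : Epi φ :=
  epi_of_epi_pullback_map_of_surjective φ g (forall_moduleFinite_stalk_of_isFiniteLocallyFree hN)

/-- **Pull-back along a surjective morphism reflects epimorphisms onto coherent modules.**
[cite: StacksProject, Tag 01B8 (Lemma 17.9.4)] [cite: Hartshorne1977, II Ex. 1.2 (b) (p. 66)] -/
theorem epi_of_epi_pullback_map_of_surjective_of_coh {X : Scheme.{u}} (g : X ⟶ T) [Surjective g]
    (hN : Coh N) [Epi ((Scheme.Modules.pullback g).map φ)] : Epi φ :=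
  epi_of_epi_pullback_map_of_surjective φ g (forall_moduleFinite_stalk_of_coh hN)

end FrontDoors

end Literature.AlgebraicGeometry.Modules
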